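import Literature.NumberTheory.BeurlingPrimes.BDRMultisetPerron
import HarnessLib

/-!
# BDR Theorem 3.2, the integer clause: `N_𝒫(x) = ax + Σ_{Re ω>1/2} x^ω Σ_{j<m_ω} b_{ω,j}(log x)^j + O(x^{1/2}e^{c(log x)^{2/3}})`

Topic `Literature/NumberTheory/BeurlingPrimes`, grouping namespace `BDRMultiset`. Everything in this file is PROVED.

Broucke–Debruyne–Révész (2023), proof of Theorem 3.2, after (3.7): "`Res_{s=ω} x^{s+1}ζ_𝒫(s)/(s(s+1)) =
x^{1+ω} Σ_{i=0}^{m_𝒮(ω)−1} β̃_{ω,i}(log x)^i` … By Lemma 3.3 … `= x^ω Σ_{i=0}^{m_𝒮(ω)−1} b̃_{ω,i}(log x)^i +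
O(x^{θ−1}(log x)^{m_𝒮(ω)−1})` … An analogous procedure … `N_𝒫(x) ≥ ∫_{x−1}^x N_𝒫(u)du` … It remains to bound the
line integral" and the final "`N_𝒫(x) = ax + Σ_{ω∈𝒮, Re ω>1/2} x^ω Σ b_{ω,i}(log x)^i + O(x^{1/2}exp(c(log x)^{2/3}))`".
Here, from the pair estimate of `BDRMultisetPerron.lean` (pairs `(x, x+1)`, `(x−1, x)`) and
`N₁(x) − N₁(x−1) ≤ N_𝒫(x) ≤ N₁(x+1) − N₁(x)`:

* `Dfun ω y = y^ω Σ_{j<m_ω} b_{ω,j}(log y)^j = (Rfun ω)′(y)` (`hasDerivAt_Rfun`), the Lemma 3.3 step as a mean value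
  argument (`norm_Dfun_sub_le`: `‖Dfun ω ξ − Dfun ω x‖ ≤ K_ω (2L)^{|𝒮|}` for `|ξ − x| ≤ 1`);
* `PerronHypM.abs_intCount_sub_le` — for `x ≥ e^{64}` with `η_x ≤ gap/2`:
  `|N_𝒫(x) − ax − Re Σ_ω Dfun ω x| ≤ a/2 + (Σ_ω K_ω)(2L)^{|𝒮|} + Eb(η_x)(768/π) x^{1/2}e^{c₀L^{2/3}}`;
* `conj_Tfun` — for symmetric data the main term `Σ_ω Dfun ω x` is real;
* `PerronHypM.intCount_clause` — **the integer clause of Theorem 3.2** on `x ≥ 2` in the vendored shape, with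
  `a = Re resA > 0`, `c = cexpo(3C/2) + 2|𝒮|`, coefficients `b = bCoef` (`b_{ω̄,j} = \overline{b_{ω,j}}`,
  `b_{ω,m_ω−1} ≠ 0` from `BDRMultisetResidues.lean`).

## References
* [BrouckeDebruyneRevesz2023] F. Broucke, G. Debruyne, Sz. Gy. Révész, *Some examples of well-behaved Beurling
  number systems*, arXiv:2309.01567, Theorem 3.2 (second assertion) and its proof (pp. 9–10) (read).
-/

noncomputable section

open Filter Topology Complex Set MeasureTheory
open scoped ComplexConjugate Nat

namespace Literature.NumberTheory.BeurlingPrimes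

open Literature.Barriers.RiemannHypothesis Literature.NumberTheory.LFunctions

namespace BDRMultiset

variable {R S : Multiset ℂ} {δ : ℝ} {M : ℕ} {Z : ℂ → ℂ} {P : BeurlingPrimes} {C : ℝ}

/-! ### Vanishing of the coefficients beyond the order -/

/-- `β_{ω,i} = 0` for `i ≥ m_ω ≥ 1`. [folklore] -/
theorem betaC_eq_zero {ω : ℂ} (hm : 1 ≤ S.count ω) {i : ℕ} (hi : S.count ω ≤ i) : betaC R S δ M Z ω i = 0 := by
  unfold betaC
  rw [Nat.choose_eq_zero_of_lt (by omega)]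
  simp

/-- `b_{ω,j} = 0` for `j ≥ m_ω ≥ 1`. [folklore] -/
theorem bCoef_eq_zero {ω : ℂ} (hm : 1 ≤ S.count ω) {j : ℕ} (hj : S.count ω ≤ j) : bCoef R S δ M Z ω j = 0 := by
  unfold bCoef
  rw [betaC_eq_zero hm hj, betaC_eq_zero hm (by omega)]
  simp

/-! ### The main-term density `Dfun ω y = y^ω Σ_j b_{ω,j}(log y)^j = (Rfun ω)′(y)` -/

/-- `Dfun ω y = y^ω Σ_{j<m_ω} b_{ω,j} (log y)^j`. [cite: BrouckeDebruyneRevesz2023, Theorem 3.2 ("x^ω Σ b_{ω,i}(log x)^i")] -/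
def Dfun (R S : Multiset ℂ) (δ : ℝ) (M : ℕ) (Z : ℂ → ℂ) (ω : ℂ) (y : ℝ) : ℂ :=
  (y : ℂ) ^ ω * ∑ j ∈ Finset.range (S.count ω), bCoef R S δ M Z ω j * (Real.log y : ℂ) ^ j

/-- The derivative coefficients of `Dfun`: `ω b_{ω,j} + (j+1) b_{ω,j+1}`. [folklore] -/
def dCoef (R S : Multiset ℂ) (δ : ℝ) (M : ℕ) (Z : ℂ → ℂ) (ω : ℂ) (j : ℕ) : ℂ :=
  ω * bCoef R S δ M Z ω j + (j + 1) * bCoef R S δ M Z ω (j + 1)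

/-- The Lipschitz constant `K_ω = Σ_{j<m_ω} ‖ω b_{ω,j} + (j+1) b_{ω,j+1}‖`. [folklore] -/
def Kb (R S : Multiset ℂ) (δ : ℝ) (M : ℕ) (Z : ℂ → ℂ) (ω : ℂ) : ℝ :=
  ∑ j ∈ Finset.range (S.count ω), ‖dCoef R S δ M Z ω j‖

/-- **`(Rfun ω)′(y) = Dfun ω y`** for `y > 0` (`Re ω > 1/2`, `ω ≠ 1`, `m_ω ≥ 1`).
[cite: BrouckeDebruyneRevesz2023, proof of Theorem 3.2 (Lemma 3.3 step)] -/
theorem hasDerivAt_Rfun (hδ2 : δ < 1 / 2) (hZ : DifferentiableOn ℂ Z {s : ℂ | 1 / 2 < s.re}) {ω : ℂ}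
    (hω : 1 / 2 < ω.re) (hω1 : ω ≠ 1) (hm : 1 ≤ S.count ω) {y : ℝ} (hy : 0 < y) :
    HasDerivAt (Rfun R S δ M Z ω) (Dfun R S δ M Z ω y) y := by
  have heq : Rfun R S δ M Z ω =ᶠ[𝓝 y] fun u : ℝ ↦
      (u : ℂ) ^ (1 + ω) * ∑ j ∈ Finset.range (S.count ω), betaC R S δ M Z ω j * (Real.log u : ℂ) ^ j := by
    filter_upwards [lt_mem_nhds hy] with u hu
    exact Rfun_eq hδ2 hZ hω hω1 hm hu
  have h := hasDerivAt_cpow_mul_logPoly hy (1 + ω) (betaC R S δ M Z ω) (S.count ω) (betaC_eq_zero hm le_rfl)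
  refine (h.congr_of_eventuallyEq heq).congr_deriv ?_
  rw [Dfun, add_sub_cancel_left]
  rfl

/-- `(Dfun ω)′(y) = y^{ω−1} Σ_j (ω b_j + (j+1) b_{j+1})(log y)^j` for `y > 0`. [folklore] -/
theorem hasDerivAt_Dfun {ω : ℂ} (hm : 1 ≤ S.count ω) {y : ℝ} (hy : 0 < y) :
    HasDerivAt (Dfun R S δ M Z ω)
      ((y : ℂ) ^ (ω - 1) * ∑ j ∈ Finset.range (S.count ω), dCoef R S δ M Z ω j * (Real.log y : ℂ) ^ j) y :=
  hasDerivAt_cpow_mul_logPoly hy ω (bCoef R S δ M Z ω) (S.count ω) (bCoef_eq_zero hm le_rfl)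

/-- The bound for `(Dfun ω)′` on `[x−1, x+1]` (`x ≥ e^{64}`, `Re ω ≤ 1`): `‖(Dfun ω)′(y)‖ ≤ K_ω (2L)^{|𝒮|}`.
[cite: BrouckeDebruyneRevesz2023, proof of Theorem 3.2 (Lemma 3.3 step)] -/
theorem norm_deriv_Dfun_le {ω : ℂ} (hω1 : ω.re ≤ 1) {x : ℝ} (hx : Real.exp 64 ≤ x) {y : ℝ}
    (hy : y ∈ Icc (x - 1) (x + 1)) :
    ‖(y : ℂ) ^ (ω - 1) * ∑ j ∈ Finset.range (S.count ω), dCoef R S δ M Z ω j * (Real.log y : ℂ) ^ j‖ ≤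
      Kb R S δ M Z ω * (2 * Real.log x) ^ (Multiset.card S) := by
  have hL := BV.log_ge hx
  have hx2 : 2 ≤ x := le_trans (by have := Real.add_one_le_exp (64:ℝ); linarith) hx
  have hy1 : 1 ≤ y := by linarith [hy.1]
  have hy0 : 0 < y := by linarith
  have hlogy0 : 0 ≤ Real.log y := Real.log_nonneg hy1
  have hlogy : Real.log y ≤ 2 * Real.log x :=
    (Real.log_le_log hy0 hy.2).trans (BV.log_succ_le hx).1
  have h2L : 1 ≤ 2 * Real.log x := by linarith
  have hpow : ‖(y : ℂ) ^ (ω - 1)‖ ≤ 1 := by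
    rw [Complex.norm_cpow_eq_rpow_re_of_pos hy0, sub_re, one_re]
    exact Real.rpow_le_one_of_one_le_of_nonpos hy1 (by linarith)
  have hsum : ‖∑ j ∈ Finset.range (S.count ω), dCoef R S δ M Z ω j * (Real.log y : ℂ) ^ j‖ ≤
      Kb R S δ M Z ω * (2 * Real.log x) ^ (Multiset.card S) := by
    rw [Kb, Finset.sum_mul]
    refine (norm_sum_le _ _).trans (Finset.sum_le_sum fun j hj ↦ ?_)
    rw [norm_mul, norm_pow, Complex.norm_real, Real.norm_eq_abs, abs_of_nonneg hlogy0]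
    refine mul_le_mul_of_nonneg_left ?_ (norm_nonneg _)
    have hjm : j ≤ Multiset.card S := (Finset.mem_range.1 hj).le.trans (Multiset.count_le_card ω S)
    calc Real.log y ^ j ≤ (2 * Real.log x) ^ j := pow_le_pow_left₀ hlogy0 hlogy j
      _ ≤ (2 * Real.log x) ^ (Multiset.card S) := pow_le_pow_right₀ h2L hjm
  have hK0 : 0 ≤ Kb R S δ M Z ω * (2 * Real.log x) ^ (Multiset.card S) := by
    have : 0 ≤ Kb R S δ M Z ω := Finset.sum_nonneg fun _ _ ↦ norm_nonneg _
    positivity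
  rw [norm_mul]
  calc _ ≤ 1 * (Kb R S δ M Z ω * (2 * Real.log x) ^ (Multiset.card S)) := mul_le_mul hpow hsum (norm_nonneg _) zero_le_one
    _ = _ := one_mul _

/-- **The Lemma 3.3 step as a Lipschitz bound**: for `x ≥ e^{64}` and `ξ ∈ [x−1, x+1]`,
`‖Dfun ω ξ − Dfun ω x‖ ≤ K_ω (2L)^{|𝒮|} |ξ − x|` (`Re ω ≤ 1`, `m_ω ≥ 1`). [cite: BrouckeDebruyneRevesz2023, Lemma 3.3 and proof of Theorem 3.2] -/
theorem norm_Dfun_sub_le {ω : ℂ} (hω1 : ω.re ≤ 1) (hm : 1 ≤ S.count ω) {x : ℝ} (hx : Real.exp 64 ≤ x) {ξ : ℝ}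
    (hξ : ξ ∈ Icc (x - 1) (x + 1)) :
    ‖Dfun R S δ M Z ω ξ - Dfun R S δ M Z ω x‖ ≤ Kb R S δ M Z ω * (2 * Real.log x) ^ (Multiset.card S) * |ξ - x| := by
  have hx2 : 2 ≤ x := le_trans (by have := Real.add_one_le_exp (64:ℝ); linarith) hx
  have hxmem : x ∈ Icc (x - 1) (x + 1) := ⟨by linarith, by linarith⟩
  have h := Convex.norm_image_sub_le_of_norm_hasDerivWithin_le (f := Dfun R S δ M Z ω) (s := Icc (x - 1) (x + 1))
    (C := Kb R S δ M Z ω * (2 * Real.log x) ^ (Multiset.card S))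
    (fun y hy ↦ (hasDerivAt_Dfun hm (by linarith [hy.1] : (0:ℝ) < y)).hasDerivWithinAt)
    (fun y hy ↦ norm_deriv_Dfun_le hω1 hx hy) (convex_Icc _ _) hxmem hξ
  rwa [Real.norm_eq_abs] at h

/-! ### The two-sided estimate for large `x` -/

/-- The main term `T(y) = Σ_{ω∈𝒮_>} Dfun ω y`. [cite: BrouckeDebruyneRevesz2023, Theorem 3.2] -/
def Tfun (R S : Multiset ℂ) (δ : ℝ) (M : ℕ) (Z : ℂ → ℂ) (y : ℝ) : ℂ := ∑ ω ∈ polesR S, Dfun R S δ M Z ω y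

/-- `Q(y) = Re Σ_{ω∈𝒮_>} Rfun ω y` has derivative `Re T(y)` for `y > 0`. [cite: BrouckeDebruyneRevesz2023, proof of Theorem 3.2] -/
theorem hasDerivAt_reRfunSum (hδ2 : δ < 1 / 2) (hZ : DifferentiableOn ℂ Z {s : ℂ | 1 / 2 < s.re})
    (hS : ∀ ω ∈ S, ω.re < 1) {y : ℝ} (hy : 0 < y) :
    HasDerivAt (fun u : ℝ ↦ (∑ ω ∈ polesR S, Rfun R S δ M Z ω u).re) (Tfun R S δ M Z y).re y := by
  have hsum : HasDerivAt (fun u : ℝ ↦ ∑ ω ∈ polesR S, Rfun R S δ M Z ω u) (Tfun R S δ M Z y) y := by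
    unfold Tfun
    refine HasDerivAt.fun_sum fun ω hω ↦ ?_
    obtain ⟨hωS, hω2⟩ := mem_polesR.1 hω
    have hω1 : ω ≠ 1 := fun e ↦ by have := hS ω hωS; rw [e] at this; simp at this
    exact hasDerivAt_Rfun hδ2 hZ hω2 hω1 (Multiset.one_le_count_iff_mem.2 hωS) hy
  have h2 : HasDerivAt (⇑Complex.reCLM ∘ fun u : ℝ ↦ ∑ ω ∈ polesR S, Rfun R S δ M Z ω u)
      (Complex.reCLM (Tfun R S δ M Z y)) y :=
    Complex.reCLM.hasFDerivAt.comp_hasDerivAt y hsum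
  rw [Complex.reCLM_apply] at h2
  exact h2.congr_of_eventuallyEq (Eventually.of_forall fun u ↦ rfl)

/-- **The mean value step**: for `1 ≤ y₁ < y₂`, `Q(y₂) − Q(y₁) = (y₂ − y₁) Re T(ξ)` for some `ξ ∈ (y₁, y₂)`.
[cite: BrouckeDebruyneRevesz2023, Lemma 3.3 (as used in the proof of Theorem 3.2)] -/
theorem exists_reRfunSum_sub_eq (hδ2 : δ < 1 / 2) (hZ : DifferentiableOn ℂ Z {s : ℂ | 1 / 2 < s.re})
    (hS : ∀ ω ∈ S, ω.re < 1) {y₁ y₂ : ℝ} (hy₁ : 0 < y₁) (hy₁₂ : y₁ < y₂) :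
    ∃ ξ ∈ Ioo y₁ y₂, (∑ ω ∈ polesR S, Rfun R S δ M Z ω y₂).re - (∑ ω ∈ polesR S, Rfun R S δ M Z ω y₁).re =
      (y₂ - y₁) * (Tfun R S δ M Z ξ).re := by
  have hd : ∀ u ∈ Icc y₁ y₂, HasDerivAt (fun u : ℝ ↦ (∑ ω ∈ polesR S, Rfun R S δ M Z ω u).re) (Tfun R S δ M Z u).re u :=
    fun u hu ↦ hasDerivAt_reRfunSum hδ2 hZ hS (lt_of_lt_of_le hy₁ hu.1)
  have hc : ContinuousOn (fun u : ℝ ↦ (∑ ω ∈ polesR S, Rfun R S δ M Z ω u).re) (Icc y₁ y₂) :=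
    fun u hu ↦ (hd u hu).continuousAt.continuousWithinAt
  obtain ⟨ξ, hξ, hξeq⟩ := exists_hasDerivAt_eq_slope (fun u : ℝ ↦ (∑ ω ∈ polesR S, Rfun R S δ M Z ω u).re)
    (fun u ↦ (Tfun R S δ M Z u).re) hy₁₂ hc (fun u hu ↦ hd u (Ioo_subset_Icc_self hu))
  refine ⟨ξ, hξ, ?_⟩
  rw [hξeq, mul_div_cancel₀ _ (by linarith)]

/-- `|Re T(ξ) − Re T(x)| ≤ (Σ_ω K_ω)(2L)^{|𝒮|}` for `ξ ∈ [x−1, x+1]`, `x ≥ e^{64}`. [cite: BrouckeDebruyneRevesz2023, proof of Theorem 3.2] -/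
theorem abs_reTfun_sub_le (hS : ∀ ω ∈ S, ω.re < 1) {x : ℝ} (hx : Real.exp 64 ≤ x) {ξ : ℝ} (hξ : ξ ∈ Icc (x - 1) (x + 1)) :
    |(Tfun R S δ M Z ξ).re - (Tfun R S δ M Z x).re| ≤
      (∑ ω ∈ polesR S, Kb R S δ M Z ω) * (2 * Real.log x) ^ (Multiset.card S) := by
  rw [← Complex.sub_re, Tfun, Tfun, ← Finset.sum_sub_distrib, Finset.sum_mul]
  refine (Complex.abs_re_le_norm _).trans ((norm_sum_le _ _).trans (Finset.sum_le_sum fun ω hω ↦ ?_))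
  obtain ⟨hωS, _⟩ := mem_polesR.1 hω
  have h := norm_Dfun_sub_le (R := R) (δ := δ) (M := M) (Z := Z) (hS ω hωS).le (Multiset.one_le_count_iff_mem.2 hωS) hx hξ
  have hξx : |ξ - x| ≤ 1 := by rw [abs_le]; constructor <;> linarith [hξ.1, hξ.2]
  have hK0 : 0 ≤ Kb R S δ M Z ω * (2 * Real.log x) ^ (Multiset.card S) := by
    have : 0 ≤ Kb R S δ M Z ω := Finset.sum_nonneg fun _ _ ↦ norm_nonneg _
    have hL := BV.log_ge hx
    positivity
  calc _ ≤ Kb R S δ M Z ω * (2 * Real.log x) ^ (Multiset.card S) * |ξ - x| := h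
    _ ≤ Kb R S δ M Z ω * (2 * Real.log x) ^ (Multiset.card S) * 1 := mul_le_mul_of_nonneg_left hξx hK0
    _ = _ := mul_one _

/-- **The integer clause for large `x`** (before absorbing the constants): for `x ≥ e^{64}` with `η_x ≤ gap/2`,
`|N_𝒫(x) − ax − Re T(x)| ≤ a/2 + (Σ_ω K_ω)(2L)^{|𝒮|} + 2·Eb(η_x)(768/2π) x^{1/2} e^{c₀L^{2/3}}`
(`N₁(x) − N₁(x−1) ≤ N(x) ≤ N₁(x+1) − N₁(x)`, the pair estimates, and the mean value step).
[cite: BrouckeDebruyneRevesz2023, Theorem 3.2 (second assertion, proof)] -/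
theorem PerronHypM.abs_intCount_sub_le (h : PerronHypM R S δ M Z P C) {x : ℝ} (hx : Real.exp 64 ≤ x)
    (hgap : BV.eta x ≤ gapS S / 2) :
    |(P.intCount x : ℝ) - (resA R S δ M Z).re * x - (Tfun R S δ M Z x).re| ≤
      (resA R S δ M Z).re / 2 + (∑ ω ∈ polesR S, Kb R S δ M Z ω) * (2 * Real.log x) ^ (Multiset.card S) +
        2 * (Eb R S δ M (BV.eta x) * (768 / (2 * Real.pi)) *
          (x ^ (1 / 2 : ℝ) * Real.exp (BV.cexpo (3 / 2 * C) * Real.log x ^ (2 / 3 : ℝ)))) := by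
  have hx2 : 2 ≤ x := le_trans (by have := Real.add_one_le_exp (64:ℝ); linarith) hx
  have hx1 : 1 ≤ x := by linarith
  have hS1 : ∀ ω ∈ S, ω.re < 1 := fun ω hω ↦ (h.hS ω hω).2
  -- the two Perron estimates
  have hup := h.abs_rieszCount_sub_sub_le hx hgap hx1 (by linarith : x ≤ x + 1) le_rfl le_rfl
  have hlo := h.abs_rieszCount_sub_sub_le hx hgap (by linarith : (1:ℝ) ≤ x - 1) (by linarith : x - 1 ≤ x)
    (by linarith) (by linarith)
  have e1 : ((x + 1) ^ 2 - x ^ 2) / 2 = x + 1 / 2 := by ring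
  have e2 : (x ^ 2 - (x - 1) ^ 2) / 2 = x - 1 / 2 := by ring
  rw [e1] at hup
  rw [e2] at hlo
  -- the mean value step on both pairs
  obtain ⟨ξ₁, hξ₁, hQ₁⟩ := exists_reRfunSum_sub_eq (R := R) (M := M) h.hδ2 h.hZd hS1 (by linarith : (0:ℝ) < x)
    (by linarith : x < x + 1)
  obtain ⟨ξ₂, hξ₂, hQ₂⟩ := exists_reRfunSum_sub_eq (R := R) (M := M) h.hδ2 h.hZd hS1 (by linarith : (0:ℝ) < x - 1)
    (by linarith : x - 1 < x)
  rw [show x + 1 - x = 1 by ring, one_mul] at hQ₁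
  rw [show x - (x - 1) = 1 by ring, one_mul] at hQ₂
  have hT₁ := abs_reTfun_sub_le (R := R) (δ := δ) (M := M) (Z := Z) hS1 hx (ξ := ξ₁) ⟨by linarith [hξ₁.1], hξ₁.2.le⟩
  have hT₂ := abs_reTfun_sub_le (R := R) (δ := δ) (M := M) (Z := Z) hS1 hx (ξ := ξ₂) ⟨hξ₂.1.le, by linarith [hξ₂.2]⟩
  -- real parts of the `Rfun` sums
  have hre₁ : (∑ ω ∈ polesR S, (Rfun R S δ M Z ω (x + 1) - Rfun R S δ M Z ω x)).re =
      (∑ ω ∈ polesR S, Rfun R S δ M Z ω (x + 1)).re - (∑ ω ∈ polesR S, Rfun R S δ M Z ω x).re := by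
    rw [Finset.sum_sub_distrib, Complex.sub_re]
  have hre₂ : (∑ ω ∈ polesR S, (Rfun R S δ M Z ω x - Rfun R S δ M Z ω (x - 1))).re =
      (∑ ω ∈ polesR S, Rfun R S δ M Z ω x).re - (∑ ω ∈ polesR S, Rfun R S δ M Z ω (x - 1)).re := by
    rw [Finset.sum_sub_distrib, Complex.sub_re]
  rw [hre₁, hQ₁] at hup
  rw [hre₂, hQ₂] at hlo
  -- sandwich
  have hN_up := P.intCount_le_rieszCount_sub x
  have hN_lo := P.rieszCount_sub_le_intCount x
  rw [abs_le] at hup hlo hT₁ hT₂ ⊢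
  obtain ⟨hup1, hup2⟩ := hup
  obtain ⟨hlo1, hlo2⟩ := hlo
  obtain ⟨hT₁1, hT₁2⟩ := hT₁
  obtain ⟨hT₂1, hT₂2⟩ := hT₂
  constructor <;> nlinarith

/-! ### The main term is real for symmetric data -/

/-- `count ω̄ 𝒮 = count ω 𝒮` for symmetric `𝒮`. [folklore] -/
theorem count_conj (hSsymm : S.map conj = S) (ω : ℂ) : S.count (conj ω) = S.count ω := by
  conv_lhs => rw [← hSsymm]
  exact Multiset.count_map_eq_count' _ _ (RingHom.injective _) _

/-- `conj` maps `𝒮_>` to itself for symmetric `𝒮`. [folklore] -/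
theorem conj_mem_polesR (hSsymm : S.map conj = S) {ω : ℂ} (hω : ω ∈ polesR S) : conj ω ∈ polesR S := by
  obtain ⟨hωS, hω2⟩ := mem_polesR.1 hω
  refine mem_polesR.2 ⟨?_, by simpa using hω2⟩
  have : conj ω ∈ S.map conj := Multiset.mem_map_of_mem _ hωS
  rwa [hSsymm] at this

/-- **`T(x)` is real**: `conj T(x) = T(x)` for symmetric `𝒮, ℛ` and `Z(s̄) = \overline{Z(s)}` (`x ≥ 0`).
[cite: BrouckeDebruyneRevesz2023, Theorem 3.2 (symmetric multisets)] -/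
theorem conj_Tfun (hSsymm : S.map conj = S) (hRsymm : R.map conj = R) (hZ : ∀ s, Z (conj s) = conj (Z s))
    {x : ℝ} (hx : 0 ≤ x) : conj (Tfun R S δ M Z x) = Tfun R S δ M Z x := by
  have hcpow : ∀ z : ℂ, conj ((x : ℂ) ^ z) = (x : ℂ) ^ (conj z) := fun z ↦ by
    rw [Complex.cpow_conj _ _ (by rw [Complex.arg_ofReal_of_nonneg hx]; exact Real.pi_ne_zero.symm), Complex.conj_ofReal]
  unfold Tfun
  rw [map_sum]
  -- reindex by `ω ↦ conj ω`
  refine Finset.sum_nbij' (fun ω ↦ conj ω) (fun ω ↦ conj ω) (fun ω hω ↦ conj_mem_polesR hSsymm hω)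
    (fun ω hω ↦ conj_mem_polesR hSsymm hω) (fun ω _ ↦ Complex.conj_conj ω) (fun ω _ ↦ Complex.conj_conj ω) ?_
  intro ω _
  unfold Dfun
  rw [map_mul, hcpow, map_sum, count_conj hSsymm]
  congr 1
  refine Finset.sum_congr rfl fun j _ ↦ ?_
  rw [map_mul, map_pow, Complex.conj_ofReal, bCoef_conj hSsymm hRsymm hZ]

/-! ### Absorbing the constants: `Eb(η_x)` and `(2L)^{|𝒮|}` -/

/-- The `x`-free constant `Eb₁ = 5 ∏_𝒮 (1 + |ω|) ∏_ℛ (1 + 2|ρ|) (1 + δ/(1/2−δ))^M`. [folklore] -/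
def Eb1 (R S : Multiset ℂ) (δ : ℝ) (M : ℕ) : ℝ :=
  5 * (S.map fun ω ↦ 1 + ‖ω‖).prod * (R.map fun ρ ↦ 1 + 2 * ‖ρ‖).prod * (1 + δ / (1 / 2 - δ)) ^ M

/-- `0 ≤ Eb₁`. [folklore] -/
theorem Eb1_nonneg (hδ : 0 ≤ δ) (hδ2 : δ < 1 / 2) : 0 ≤ Eb1 R S δ M := by
  unfold Eb1
  have h1 : 0 ≤ (S.map fun ω ↦ 1 + ‖ω‖).prod :=
    Multiset.prod_nonneg fun y hy ↦ by obtain ⟨b, _, rfl⟩ := Multiset.mem_map.1 hy; positivity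
  have h2 : 0 ≤ (R.map fun ρ ↦ 1 + 2 * ‖ρ‖).prod :=
    Multiset.prod_nonneg fun y hy ↦ by obtain ⟨b, _, rfl⟩ := Multiset.mem_map.1 hy; positivity
  have h3 : 0 ≤ 1 + δ / (1 / 2 - δ) := by
    have : 0 < 1 / 2 - δ := by linarith
    positivity
  positivity

/-- `Eb(η) ≤ Eb₁ η^{−|𝒮|}` for `0 < η ≤ 1`. [folklore] -/
theorem Eb_le_Eb1_mul (hδ : 0 ≤ δ) (hδ2 : δ < 1 / 2) {η : ℝ} (hη : 0 < η) (hη1 : η ≤ 1) :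
    Eb R S δ M η ≤ Eb1 R S δ M * (1 / η) ^ (Multiset.card S) := by
  have hprod : (S.map fun ω ↦ 1 + ‖ω‖ / η).prod ≤ (S.map fun ω ↦ 1 + ‖ω‖).prod * (1 / η) ^ (Multiset.card S) := by
    have h1 : (S.map fun ω ↦ 1 + ‖ω‖ / η).prod ≤ (S.map fun ω ↦ (1 + ‖ω‖) * (1 / η)).prod :=
      Multiset.prod_map_le_prod_map₀ _ _ (fun ω _ ↦ by positivity) fun ω _ ↦ by
        rw [mul_one_div, le_div_iff₀ hη]
        have : 0 ≤ ‖ω‖ := norm_nonneg _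
        nlinarith [div_mul_cancel₀ ‖ω‖ hη.ne']
    refine h1.trans (le_of_eq ?_)
    rw [Multiset.prod_map_mul, Multiset.map_const', Multiset.prod_replicate]
  have h2 : 0 ≤ (R.map fun ρ ↦ 1 + 2 * ‖ρ‖).prod :=
    Multiset.prod_nonneg fun y hy ↦ by obtain ⟨b, _, rfl⟩ := Multiset.mem_map.1 hy; positivity
  have h3 : 0 ≤ (1 + δ / (1 / 2 - δ)) ^ M := by
    have : 0 < 1 / 2 - δ := by linarith
    positivity
  unfold Eb Eb1
  calc 5 * (S.map fun ω ↦ 1 + ‖ω‖ / η).prod * (R.map fun ρ ↦ 1 + 2 * ‖ρ‖).prod * (1 + δ / (1 / 2 - δ)) ^ M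
      ≤ 5 * ((S.map fun ω ↦ 1 + ‖ω‖).prod * (1 / η) ^ (Multiset.card S)) * (R.map fun ρ ↦ 1 + 2 * ‖ρ‖).prod *
          (1 + δ / (1 / 2 - δ)) ^ M := by gcongr
    _ = _ := by ring

/-- `1/η_x = L^{1/3} ≤ e^{(1/2)L^{2/3}}` and `2L ≤ 2 e^{(3/2) L^{2/3}}`, hence the power bounds
`(1/η_x)^k ≤ e^{(k/2)L^{2/3}}`, `(2L)^k ≤ 2^k e^{(3k/2)L^{2/3}}` (`x ≥ e^{64}`). [folklore] -/
theorem pow_bounds {x : ℝ} (hx : Real.exp 64 ≤ x) (k : ℕ) :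
    (1 / BV.eta x) ^ k ≤ Real.exp (k / 2 * Real.log x ^ (2 / 3 : ℝ)) ∧
      (2 * Real.log x) ^ k ≤ 2 ^ k * Real.exp (3 * k / 2 * Real.log x ^ (2 / 3 : ℝ)) := by
  have hL := BV.log_ge hx
  set L := Real.log x with hLdef
  have hL0 : 0 < L := by linarith
  have h1 : 1 / BV.eta x = L ^ (1 / 3 : ℝ) := BV.one_div_eta hx
  have h2 : L ^ (1 / 3 : ℝ) ≤ Real.exp (1 / 2 * L ^ (2 / 3 : ℝ)) := by
    have hlog : Real.log L ≤ L ^ (2 / 3 : ℝ) / (2 / 3) := Real.log_le_rpow_div hL0.le (by norm_num)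
    rw [Real.rpow_def_of_pos hL0]
    refine Real.exp_le_exp.mpr ?_
    have : Real.log L * (1 / 3) ≤ (L ^ (2 / 3 : ℝ) / (2 / 3)) * (1 / 3) := by nlinarith
    linarith [this]
  have h3 : L ≤ Real.exp (3 / 2 * L ^ (2 / 3 : ℝ)) := BV.log_le_exp hx
  constructor
  · rw [h1]
    calc (L ^ (1 / 3 : ℝ)) ^ k ≤ (Real.exp (1 / 2 * L ^ (2 / 3 : ℝ))) ^ k :=
          pow_le_pow_left₀ (Real.rpow_nonneg hL0.le _) h2 k
      _ = Real.exp (k / 2 * L ^ (2 / 3 : ℝ)) := by rw [← Real.exp_nat_mul]; congr 1; ring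
  · calc (2 * L) ^ k ≤ (2 * Real.exp (3 / 2 * L ^ (2 / 3 : ℝ))) ^ k :=
          pow_le_pow_left₀ (by linarith) (by linarith) k
      _ = 2 ^ k * Real.exp (3 * k / 2 * L ^ (2 / 3 : ℝ)) := by
          rw [mul_pow, ← Real.exp_nat_mul]; congr 1; congr 1; ring

/-- **The threshold**: for all large `x`, `η_x ≤ gap/2` (with a threshold `X₀ ≥ e^{64}`). [cite: BrouckeDebruyneRevesz2023, proof of Theorem 3.2 (choice of σ_x)] -/
theorem exists_threshold (S : Multiset ℂ) : ∃ X₀ : ℝ, Real.exp 64 ≤ X₀ ∧ ∀ x : ℝ, X₀ ≤ x → BV.eta x ≤ gapS S / 2 := by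
  have hη : Tendsto BV.eta atTop (𝓝 0) :=
    (tendsto_rpow_neg_atTop (by norm_num : (0:ℝ) < 1 / 3)).comp Real.tendsto_log_atTop
  have hg : (0 : ℝ) < gapS S / 2 := by have := (gapS_pos_le (S := S)).1; linarith
  have hev : ∀ᶠ x in atTop, BV.eta x ≤ gapS S / 2 := hη.eventually (Iic_mem_nhds hg)
  obtain ⟨X₀, hX₀⟩ := (hev.and (eventually_ge_atTop (Real.exp 64))).exists_forall_of_atTop
  exact ⟨X₀, (hX₀ X₀ le_rfl).2, fun x hx ↦ (hX₀ x hx).1⟩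

/-! ### The integer clause -/

/-- **BDR Theorem 3.2, the integer clause** (vendored shape of `BrouckeDebruyneRevesz2023_thm32_multiset`): with
`a = Re resA > 0`, `c = cexpo(3C/2) + 2|𝒮| > 0` and `b = bCoef`, for all `x ≥ 2`
`‖N_𝒫(x) − (ax + Σ_{ω∈𝒮, Re ω>1/2} x^ω Σ_{j<m_ω} b_{ω,j}(log x)^j)‖ ≤ C' x^{1/2} exp(c (log x)^{2/3})`
(symmetric data, so that the main term is real). [cite: BrouckeDebruyneRevesz2023, Theorem 3.2 (second assertion)] -/
theorem PerronHypM.intCount_clause (h : PerronHypM R S δ M Z P C) (hSsymm : S.map conj = S) (hRsymm : R.map conj = R)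
    (hZsymm : ∀ s, Z (conj s) = conj (Z s)) :
    ∃ C' : ℝ, ∀ x : ℝ, 2 ≤ x →
      ‖(P.intCount x : ℂ) - ((((resA R S δ M Z).re * x : ℝ) : ℂ) +
          ∑ ω ∈ S.toFinset.filter (fun ω ↦ 1 / 2 < ω.re), (x : ℂ) ^ ω *
            ∑ j ∈ Finset.range (S.count ω), bCoef R S δ M Z ω j * ((Real.log x : ℝ) : ℂ) ^ j)‖ ≤
        C' * (x ^ (1 / 2 : ℝ) * Real.exp ((BV.cexpo (3 / 2 * C) + 2 * Multiset.card S) * Real.log x ^ (2 / 3 : ℝ))) := by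
  obtain ⟨X₀, hX₀, hgap⟩ := exists_threshold S
  have hS1 : ∀ ω ∈ S, ω.re < 1 := fun ω hω ↦ (h.hS ω hω).2
  have hR1 : ∀ ρ ∈ R, ρ.re < 1 := fun ρ hρ ↦ (h.hR ρ hρ).2
  have hZ1 : DifferentiableAt ℂ Z 1 :=
    h.hZd.differentiableAt ((isOpen_lt continuous_const Complex.continuous_re).mem_nhds (by norm_num))
  set a : ℝ := (resA R S δ M Z).re with ha
  have ha0 : 0 < a := (resA_real_pos h.hδ2 hS1 hR1 h.hzeta hZ1).2
  set c₀ : ℝ := BV.cexpo (3 / 2 * C) with hc₀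
  set c : ℝ := c₀ + 2 * Multiset.card S with hc
  have hc₀0 : 0 < c₀ := by have := h.hC; rw [hc₀]; unfold BV.cexpo; positivity
  have hc0 : 0 < c := by rw [hc]; positivity
  set K : ℝ := ∑ ω ∈ polesR S, Kb R S δ M Z ω with hK
  have hK0 : 0 ≤ K := Finset.sum_nonneg fun _ _ ↦ Finset.sum_nonneg fun _ _ ↦ norm_nonneg _
  have hE1 := Eb1_nonneg (R := R) (S := S) (M := M) h.hδ h.hδ2
  -- the bound for small `x`
  set Bb : ℝ := ∑ ω ∈ polesR S, ∑ j ∈ Finset.range (S.count ω), ‖bCoef R S δ M Z ω j‖ with hBb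
  have hBb0 : 0 ≤ Bb := Finset.sum_nonneg fun _ _ ↦ Finset.sum_nonneg fun _ _ ↦ norm_nonneg _
  set Bsmall : ℝ := (P.intCount X₀ : ℝ) + a * X₀ + Bb * X₀ * (1 + Real.log X₀) ^ (Multiset.card S) with hBsmall
  have hX₀1 : 1 ≤ X₀ := le_trans (by have := Real.add_one_le_exp (64:ℝ); linarith) hX₀
  have hBsmall0 : 0 ≤ Bsmall := by
    rw [hBsmall]
    have : 0 ≤ Real.log X₀ := Real.log_nonneg hX₀1
    positivity
  set Clarge : ℝ := a / 2 + K * 2 ^ (Multiset.card S) + 2 * (Eb1 R S δ M * (768 / (2 * Real.pi))) with hClarge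
  have hClarge0 : 0 ≤ Clarge := by rw [hClarge]; positivity
  refine ⟨Clarge + Bsmall, fun x hx ↦ ?_⟩
  have hx1 : 1 ≤ x := by linarith
  have hx0 : 0 ≤ x := by linarith
  have hL0 : 0 ≤ Real.log x := Real.log_nonneg hx1
  -- the main term is real, so the complex norm is a real absolute value
  have hTdef : ∑ ω ∈ S.toFinset.filter (fun ω ↦ 1 / 2 < ω.re), (x : ℂ) ^ ω *
      ∑ j ∈ Finset.range (S.count ω), bCoef R S δ M Z ω j * ((Real.log x : ℝ) : ℂ) ^ j = Tfun R S δ M Z x := rfl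
  have hTreal : Tfun R S δ M Z x = (((Tfun R S δ M Z x).re : ℝ) : ℂ) :=
    (Complex.conj_eq_iff_re.1 (conj_Tfun hSsymm hRsymm hZsymm hx0)).symm
  have hnorm : ‖(P.intCount x : ℂ) - ((((resA R S δ M Z).re * x : ℝ) : ℂ) +
      ∑ ω ∈ S.toFinset.filter (fun ω ↦ 1 / 2 < ω.re), (x : ℂ) ^ ω *
        ∑ j ∈ Finset.range (S.count ω), bCoef R S δ M Z ω j * ((Real.log x : ℝ) : ℂ) ^ j)‖ =
      |(P.intCount x : ℝ) - a * x - (Tfun R S δ M Z x).re| := by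
    rw [hTdef, ← ha]
    have : ((P.intCount x : ℕ) : ℂ) = (((P.intCount x : ℕ) : ℝ) : ℂ) := by push_cast; rfl
    rw [this]
    conv_lhs => rw [hTreal, ← Complex.ofReal_add, ← Complex.ofReal_sub, Complex.norm_real, Real.norm_eq_abs]
    congr 1; ring
  rw [hnorm]
  set Xg : ℝ := x ^ (1 / 2 : ℝ) * Real.exp (c * Real.log x ^ (2 / 3 : ℝ)) with hXg
  have hXg1 : 1 ≤ Xg := by
    have h1 : 1 ≤ x ^ (1 / 2 : ℝ) := Real.one_le_rpow hx1 (by norm_num)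
    have h2 : 1 ≤ Real.exp (c * Real.log x ^ (2 / 3 : ℝ)) :=
      Real.one_le_exp (mul_nonneg hc0.le (Real.rpow_nonneg hL0 _))
    rw [hXg]; nlinarith
  show _ ≤ (Clarge + Bsmall) * Xg
  rcases le_or_gt X₀ x with hxX | hxX
  · -- large `x`
    have hxe : Real.exp 64 ≤ x := hX₀.trans hxX
    have hη := BV.eta_pos hxe
    have hη1 : BV.eta x ≤ 1 := (BV.eta_le hxe).trans (by norm_num)
    have hmain := h.abs_intCount_sub_le hxe (hgap x hxX)
    obtain ⟨hp1, hp2⟩ := pow_bounds hxe (Multiset.card S)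
    have hEb := Eb_le_Eb1_mul (R := R) (S := S) (M := M) h.hδ h.hδ2 hη hη1
    have hx12 : 0 ≤ x ^ (1 / 2 : ℝ) := Real.rpow_nonneg hx0 _
    have hx12' : 1 ≤ x ^ (1 / 2 : ℝ) := Real.one_le_rpow hx1 (by norm_num)
    set E2 := Real.log x ^ (2 / 3 : ℝ) with hE2
    have hE20 : 0 ≤ E2 := Real.rpow_nonneg hL0 _
    -- (i) `(2L)^{|S|} ≤ 2^{|S|} Xg`
    have hi : (2 * Real.log x) ^ (Multiset.card S) ≤ 2 ^ (Multiset.card S) * Xg := by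
      refine hp2.trans ?_
      rw [hXg]
      have hexp : Real.exp (3 * (Multiset.card S) / 2 * E2) ≤ Real.exp (c * E2) :=
        Real.exp_le_exp.2 (mul_le_mul_of_nonneg_right (by rw [hc]; linarith [hc₀0.le]) hE20)
      have : Real.exp (3 * (Multiset.card S) / 2 * E2) ≤ x ^ (1 / 2 : ℝ) * Real.exp (c * E2) := by
        calc _ ≤ 1 * Real.exp (c * E2) := by rw [one_mul]; exact hexp
          _ ≤ x ^ (1 / 2 : ℝ) * Real.exp (c * E2) := mul_le_mul_of_nonneg_right hx12' (Real.exp_pos _).le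
      exact mul_le_mul_of_nonneg_left this (by positivity)
    -- (ii) `Eb(η_x) x^{1/2} e^{c₀ E2} ≤ Eb₁ Xg`
    have hii : Eb R S δ M (BV.eta x) * (x ^ (1 / 2 : ℝ) * Real.exp (c₀ * E2)) ≤ Eb1 R S δ M * Xg := by
      have h1 : Eb R S δ M (BV.eta x) ≤ Eb1 R S δ M * Real.exp ((Multiset.card S) / 2 * E2) :=
        hEb.trans (mul_le_mul_of_nonneg_left hp1 hE1)
      calc Eb R S δ M (BV.eta x) * (x ^ (1 / 2 : ℝ) * Real.exp (c₀ * E2))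
          ≤ Eb1 R S δ M * Real.exp ((Multiset.card S) / 2 * E2) * (x ^ (1 / 2 : ℝ) * Real.exp (c₀ * E2)) :=
            mul_le_mul_of_nonneg_right h1 (by positivity)
        _ = Eb1 R S δ M * (x ^ (1 / 2 : ℝ) * Real.exp (((Multiset.card S) / 2 + c₀) * E2)) := by
            rw [add_mul, Real.exp_add]; ring
        _ ≤ Eb1 R S δ M * Xg := by
            rw [hXg]
            refine mul_le_mul_of_nonneg_left (mul_le_mul_of_nonneg_left (Real.exp_le_exp.2 ?_) hx12) hE1
            exact mul_le_mul_of_nonneg_right (by rw [hc]; linarith) hE20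
    have hiii : a / 2 ≤ a / 2 * Xg := le_mul_of_one_le_right (by linarith) hXg1
    calc |(P.intCount x : ℝ) - a * x - (Tfun R S δ M Z x).re|
        ≤ a / 2 + K * (2 * Real.log x) ^ (Multiset.card S) +
            2 * (Eb R S δ M (BV.eta x) * (768 / (2 * Real.pi)) * (x ^ (1 / 2 : ℝ) * Real.exp (c₀ * E2))) := hmain
      _ ≤ a / 2 * Xg + K * (2 ^ (Multiset.card S) * Xg) + 2 * ((768 / (2 * Real.pi)) * (Eb1 R S δ M * Xg)) := by
          refine add_le_add (add_le_add hiii (mul_le_mul_of_nonneg_left hi hK0)) ?_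
          have : Eb R S δ M (BV.eta x) * (768 / (2 * Real.pi)) * (x ^ (1 / 2 : ℝ) * Real.exp (c₀ * E2)) =
              (768 / (2 * Real.pi)) * (Eb R S δ M (BV.eta x) * (x ^ (1 / 2 : ℝ) * Real.exp (c₀ * E2))) := by ring
          rw [this]
          exact mul_le_mul_of_nonneg_left (mul_le_mul_of_nonneg_left hii (by positivity)) (by norm_num)
      _ = Clarge * Xg := by rw [hClarge]; ring
      _ ≤ (Clarge + Bsmall) * Xg := by nlinarith
  · -- small `x`: everything is bounded
    have hN : ((P.intCount x : ℝ)) ≤ P.intCount X₀ := by exact_mod_cast P.intCount_mono hxX.le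
    have hN0 : (0 : ℝ) ≤ P.intCount x := Nat.cast_nonneg _
    have hlogX : Real.log x ≤ Real.log X₀ := Real.log_le_log (by linarith) hxX.le
    have hT : |(Tfun R S δ M Z x).re| ≤ Bb * X₀ * (1 + Real.log X₀) ^ (Multiset.card S) := by
      refine (Complex.abs_re_le_norm _).trans ?_
      rw [Tfun, hBb, Finset.sum_mul, Finset.sum_mul]
      refine (norm_sum_le _ _).trans (Finset.sum_le_sum fun ω hω ↦ ?_)
      obtain ⟨hωS, _⟩ := mem_polesR.1 hω
      have hre := h.hS ω hωS
      rw [Dfun, norm_mul, Complex.norm_cpow_eq_rpow_re_of_pos (by linarith)]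
      have hxω : x ^ ω.re ≤ X₀ := by
        calc x ^ ω.re ≤ x ^ (1 : ℝ) := Real.rpow_le_rpow_of_exponent_le hx1 hre.2.le
          _ = x := Real.rpow_one x
          _ ≤ X₀ := hxX.le
      have hinner : ‖∑ j ∈ Finset.range (S.count ω), bCoef R S δ M Z ω j * ((Real.log x : ℝ) : ℂ) ^ j‖ ≤
          (∑ j ∈ Finset.range (S.count ω), ‖bCoef R S δ M Z ω j‖) * (1 + Real.log X₀) ^ (Multiset.card S) := by
        rw [Finset.sum_mul]
        refine (norm_sum_le _ _).trans (Finset.sum_le_sum fun j hj ↦ ?_)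
        rw [norm_mul, norm_pow, Complex.norm_real, Real.norm_eq_abs, abs_of_nonneg hL0]
        refine mul_le_mul_of_nonneg_left ?_ (norm_nonneg _)
        have hjm : j ≤ Multiset.card S := (Finset.mem_range.1 hj).le.trans (Multiset.count_le_card ω S)
        calc Real.log x ^ j ≤ (1 + Real.log X₀) ^ j := pow_le_pow_left₀ hL0 (by linarith) j
          _ ≤ (1 + Real.log X₀) ^ (Multiset.card S) := pow_le_pow_right₀ (by linarith [Real.log_nonneg hX₀1]) hjm
      have h0 : 0 ≤ ∑ j ∈ Finset.range (S.count ω), ‖bCoef R S δ M Z ω j‖ := Finset.sum_nonneg fun _ _ ↦ norm_nonneg _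
      have h0' : 0 ≤ (1 + Real.log X₀) ^ (Multiset.card S) := by have := Real.log_nonneg hX₀1; positivity
      calc x ^ ω.re * ‖∑ j ∈ Finset.range (S.count ω), bCoef R S δ M Z ω j * ((Real.log x : ℝ) : ℂ) ^ j‖
          ≤ X₀ * ((∑ j ∈ Finset.range (S.count ω), ‖bCoef R S δ M Z ω j‖) * (1 + Real.log X₀) ^ (Multiset.card S)) :=
            mul_le_mul hxω hinner (norm_nonneg _) (by linarith)
        _ = (∑ j ∈ Finset.range (S.count ω), ‖bCoef R S δ M Z ω j‖) * X₀ * (1 + Real.log X₀) ^ (Multiset.card S) := by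
            ring
    have h1 : |(P.intCount x : ℝ) - a * x - (Tfun R S δ M Z x).re| ≤ Bsmall := by
      rw [abs_le] at hT ⊢
      have hax : a * x ≤ a * X₀ := mul_le_mul_of_nonneg_left hxX.le ha0.le
      have hax0 : 0 ≤ a * x := by positivity
      rw [hBsmall]
      constructor <;> linarith [hT.1, hT.2]
    calc _ ≤ Bsmall := h1
      _ ≤ Bsmall * Xg := le_mul_of_one_le_right hBsmall0 hXg1
      _ ≤ (Clarge + Bsmall) * Xg := by nlinarith

end BDRMultiset

end Literature.NumberTheory.BeurlingPrimes
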